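import Literature.AlgebraicTopology.FundamentalGroup.VanKampenTwoComponents
import Literature.AlgebraicTopology.FundamentalGroup.FreeGroupPuncturedPlane
import Mathlib.Analysis.Complex.Convex
import Mathlib.Analysis.Convex.Contractible
import Mathlib.Topology.OpenPartialHomeomorph.Basic
import HarnessLib

/-!
# Two punctures in one chart: `π₁(Y ∖ (S ∪ {a, b})) ≅ π₁(Y ∖ (S ∪ {a})) ∗ ℤ`

Topic `Literature/AlgebraicTopology/FundamentalGroup`.  The local step of the computation of the
fundamental group of a punctured surface (A. Hatcher, *Algebraic Topology* (2002), §1.2, Example 1.22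
and the discussion after Thm. 1.20: each further puncture of a punctured surface adds a free factor `ℤ`;
W. S. Massey, *Algebraic Topology: An Introduction* (1967), Ch. 4 §5).  We prove it in the following
chart-local form, for an ARBITRARY Hausdorff space `Y` (no manifold structure is used away from the
chart):

> Let `e` be a partial homeomorphism from `Y` to `ℂ` (a chart), `a ≠ b` two points of its source whose
> images lie in a ball `B ⊆ e.target` about `e a`, `S ⊆ Y` a closed set not meeting the chart ball
> `e⁻¹(B)`, and suppose that the complement of `S ∪ e⁻¹[e a, e b]` (the other punctures together with
> the chart segment joining `a` to `b`) is path connected.  Then for all base points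
> `π₁(Y ∖ (S ∪ {a, b})) ≅ π₁(Y ∖ (S ∪ {a})) ∗ ℤ`
> (`ChartSegment.nonempty_mulEquiv_coprod_int`).

PROOF (Seifert–van Kampen, twice).  Write `K = e⁻¹[e a, e b]` for the chart segment and use the chart
coordinate `w = (z - e a)/(e b - e a)`, in which `K` is `[0, 1]`.
* `Y ∖ (S ∪ {a, b})` is covered by `U = Y ∖ (S ∪ K)` and the *twice-slit lens*
  `T = e⁻¹(B ∩ {w ∈ ℂ ∖ (-∞, 0] ∖ [1, ∞)})` (star-shaped about `w = 1/2`, hence simply connected),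
  which meet in the two half-lenses `{± Im w > 0}` (convex, simply connected).  The HNN / free-product
  form of van Kampen's theorem for an intersection with TWO simply connected components (the tree's
  `VanKampen.fundamentalGroupEquivCoprodInt`) gives `π₁(Y ∖ (S ∪ {a,b})) ≅ π₁(U) ∗ ℤ`.
* `Y ∖ (S ∪ {a})` is covered by the same `U` and the *slit lens* `T' = e⁻¹(B ∩ {w ∈ ℂ ∖ (-∞, 0]})`
  (star-shaped), meeting in the slit lens `e⁻¹(B ∩ {w ∉ (-∞, 1]})` (star-shaped about a point just
  beyond `b`, simply connected); the free-product form with simply connected intersection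
  (`VanKampen.fundamentalGroupEquivCoprod`) gives `π₁(Y ∖ (S ∪ {a})) ≅ π₁(U) ∗ 1 ≅ π₁(U)`.

Main statements (`ChartSegment` namespace): `isPathConnected_compl_insert_insert`,
`isPathConnected_compl_insert` (both punctured spaces are path connected),
**`nonempty_mulEquiv_coprod_int`** (the isomorphism, arbitrary base points), and the local input
`isPathConnected_chartBall_diff_segment` (chart ball minus chart segment is path connected) used to
verify the connectivity hypothesis on surfaces.  Everything is proved; the
only definitions are PRIVATE plumbing (the coordinate, the chart pieces, straight-line chart paths, the
packaged hypotheses); no instances, no named facts.  Classical; written for the abc-iut cell's geometric column of [AbsTopIII]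
Prop. 4.2 (i) / Cor. 4.5 (input (α): `π₁` of punctured Riemann surfaces is free), nothing here bears on
[IUTchIII] Cor. 3.12.

## References
* A. Hatcher, *Algebraic Topology*, CUP (2002), §1.2 Thm. 1.20, Example 1.22; §1.B. [HatcherAT2002]
* W. S. Massey, *Algebraic Topology: An Introduction*, GTM 56 (1967/1977), Ch. 4 §5.
  [Massey1967AlgebraicTopology]
-/

noncomputable section

open Set Function Metric Complex
open scoped Topology unitInterval

namespace Literature.AlgebraicTopology.FundamentalGroup

namespace ChartSegment

/-! ### §1 Planar geometry in the coordinate `w = (z - z_a) / (z_b - z_a)` -/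

section Plane

variable {za zb : ℂ}

/-- The affine coordinate in which `z_a ↦ 0`, `z_b ↦ 1`. [folklore] -/
private def coord (za zb z : ℂ) : ℂ := (z - za) / (zb - za)

/-- The inverse coordinate. [folklore] -/
private def pt (za zb w : ℂ) : ℂ := za + w * (zb - za)

/-- Helper. [folklore] -/
private theorem coord_pt (hab : za ≠ zb) (w : ℂ) : coord za zb (pt za zb w) = w := by
  have hv : zb - za ≠ 0 := sub_ne_zero.2 (Ne.symm hab)
  simp only [coord, pt, add_sub_cancel_left, mul_div_assoc, div_self hv, mul_one]

/-- Helper. [folklore] -/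
private theorem pt_coord (hab : za ≠ zb) (z : ℂ) : pt za zb (coord za zb z) = z := by
  have hv : zb - za ≠ 0 := sub_ne_zero.2 (Ne.symm hab)
  simp only [coord, pt, div_mul_cancel₀ _ hv, add_sub_cancel]

/-- Helper. [folklore] -/
private theorem coord_self_left (za zb : ℂ) : coord za zb za = 0 := by simp [coord]

/-- Helper. [folklore] -/
private theorem coord_self_right (hab : za ≠ zb) : coord za zb zb = 1 := by
  have hv : zb - za ≠ 0 := sub_ne_zero.2 (Ne.symm hab)
  simp [coord, div_self hv]

/-- Helper. [folklore] -/
private theorem continuous_coord (za zb : ℂ) : Continuous (coord za zb) := by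
  unfold coord; fun_prop

/-- Helper. [folklore] -/
private theorem continuous_pt (za zb : ℂ) : Continuous (pt za zb) := by
  unfold pt; fun_prop

/-- `coord` is real-affine: it commutes with two-point barycentres. [folklore] -/
private theorem coord_lineComb (za zb c y : ℂ) {s t : ℝ} (hst : s + t = 1) :
    coord za zb (s • c + t • y) = s • coord za zb c + t • coord za zb y := by
  simp only [coord, Complex.real_smul]
  have h1 : (s : ℂ) + (t : ℂ) = 1 := by exact_mod_cast hst
  have : (s : ℂ) * c + (t : ℂ) * y - za = (s : ℂ) * (c - za) + (t : ℂ) * (y - za) := by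
    linear_combination za * h1
  rw [this, add_div, mul_div_assoc, mul_div_assoc]

/-- Star-convexity pulls back along the affine coordinate. [folklore] -/
private theorem starConvex_preimage_coord {c : ℂ} {A : Set ℂ}
    (h : StarConvex ℝ (coord za zb c) A) : StarConvex ℝ c (coord za zb ⁻¹' A) := by
  intro y hy s t hs ht hst
  show coord za zb (s • c + t • y) ∈ A
  rw [coord_lineComb za zb c y hst]
  exact h hy hs ht hst

/-- The chart segment in coordinates: `z ∈ [z_a, z_b]` iff `w ∈ [0, 1] ⊆ ℝ`. [folklore] -/
private theorem mem_segment_iff (hab : za ≠ zb) {z : ℂ} :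
    z ∈ segment ℝ za zb ↔ (coord za zb z).im = 0 ∧ 0 ≤ (coord za zb z).re ∧ (coord za zb z).re ≤ 1 := by
  rw [segment_eq_image']
  constructor
  · rintro ⟨θ, ⟨h0, h1⟩, rfl⟩
    have : coord za zb (za + θ • (zb - za)) = (θ : ℂ) := by
      rw [Complex.real_smul]; exact coord_pt hab θ
    rw [this]
    exact ⟨Complex.ofReal_im θ, by rwa [Complex.ofReal_re], by rwa [Complex.ofReal_re]⟩
  · rintro ⟨him, h0, h1⟩
    refine ⟨(coord za zb z).re, ⟨h0, h1⟩, ?_⟩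
    have hw : coord za zb z = ((coord za zb z).re : ℂ) := by
      apply Complex.ext <;> simp [him]
    show za + (coord za zb z).re • (zb - za) = z
    rw [Complex.real_smul, ← hw]
    exact pt_coord hab z

/-! #### The slit planes used as lenses -/

/-- Twice-slit plane `ℂ ∖ ((-∞, 0] ∪ [1, ∞))`. [folklore] -/
private def lens₂ : Set ℂ := {w | w ∈ slitPlane ∧ 1 - w ∈ slitPlane}

/-- Slit plane beyond `1`: `ℂ ∖ (-∞, 1]`. [folklore] -/
private def lens₁' : Set ℂ := {w | w - 1 ∈ slitPlane}

/-- Helper. [folklore] -/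
private theorem mem_lens₂_iff {w : ℂ} :
    w ∈ lens₂ ↔ (0 < w.re ∨ w.im ≠ 0) ∧ (w.re < 1 ∨ w.im ≠ 0) := by
  simp only [lens₂, mem_setOf_eq, mem_slitPlane_iff, sub_re, one_re, sub_im, one_im, zero_sub,
    neg_ne_zero, sub_pos]

/-- Helper. [folklore] -/
private theorem mem_lens₁'_iff {w : ℂ} : w ∈ lens₁' ↔ 1 < w.re ∨ w.im ≠ 0 := by
  simp only [lens₁', mem_setOf_eq, mem_slitPlane_iff, sub_re, one_re, sub_im, one_im, sub_zero,
    sub_pos]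

/-- Helper. [folklore] -/
private theorem isOpen_lens₂ : IsOpen lens₂ :=
  (isOpen_slitPlane).inter (isOpen_slitPlane.preimage (by fun_prop))

/-- Helper. [folklore] -/
private theorem isOpen_lens₁' : IsOpen lens₁' := isOpen_slitPlane.preimage (by fun_prop)

/-- `lens₂` is star-shaped about `1/2`. [folklore] -/
private theorem starConvex_lens₂ : StarConvex ℝ ((1 / 2 : ℝ) : ℂ) lens₂ := by
  have h1 : StarConvex ℝ ((1 / 2 : ℝ) : ℂ) slitPlane := starConvex_ofReal_slitPlane (by norm_num)
  -- `{w | 1 - w ∈ slitPlane}` is the preimage of `slitPlane` under the coordinate `coord 1 0 w = 1 - w`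
  have h2 : StarConvex ℝ ((1 / 2 : ℝ) : ℂ) {w : ℂ | 1 - w ∈ slitPlane} := by
    have hc : coord 1 0 ((1 / 2 : ℝ) : ℂ) = ((1 / 2 : ℝ) : ℂ) := by
      simp only [coord]; push_cast; ring
    have := starConvex_preimage_coord (za := 1) (zb := 0) (c := ((1 / 2 : ℝ) : ℂ))
      (A := slitPlane) (by rw [hc]; exact h1)
    convert this using 1
    ext w
    simp only [mem_setOf_eq, mem_preimage, coord]
    ring_nf
  exact h1.inter h2

/-- `lens₁'` is star-shaped about every real point `1 + t`, `t > 0`. [folklore] -/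
private theorem starConvex_lens₁' {t : ℝ} (ht : 0 < t) : StarConvex ℝ ((1 + t : ℝ) : ℂ) lens₁' := by
  have h1 : StarConvex ℝ ((t : ℝ) : ℂ) slitPlane := starConvex_ofReal_slitPlane ht
  have hc : coord 1 2 ((1 + t : ℝ) : ℂ) = (t : ℂ) := by
    simp only [coord]; push_cast; ring
  have := starConvex_preimage_coord (za := 1) (zb := 2) (c := ((1 + t : ℝ) : ℂ))
    (A := slitPlane) (by rw [hc]; exact h1)
  convert this using 1
  ext w
  simp only [lens₁', mem_setOf_eq, mem_preimage, coord]
  ring_nf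

/-- The open upper half plane is convex. [folklore] -/
private theorem convex_im_pos : Convex ℝ {w : ℂ | 0 < w.im} :=
  convex_halfSpace_gt ⟨fun x y => Complex.add_im x y, fun c x => by simp⟩ 0

/-- The open lower half plane is convex. [folklore] -/
private theorem convex_im_neg : Convex ℝ {w : ℂ | w.im < 0} :=
  convex_halfSpace_lt ⟨fun x y => Complex.add_im x y, fun c x => by simp⟩ 0

/-! #### Pointwise facts about the pieces (segment `[0,1]`, lenses, half planes) -/

/-- Cover for two punctures: a point other than `0, 1` is off the segment or in the twice-slit lens. [folklore] -/
private theorem not_seg_or_lens₂ {w : ℂ} (h0 : w ≠ 0) (h1 : w ≠ 1) :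
    ¬ (w.im = 0 ∧ 0 ≤ w.re ∧ w.re ≤ 1) ∨ w ∈ lens₂ := by
  by_cases him : w.im = 0
  · by_cases hseg : 0 ≤ w.re ∧ w.re ≤ 1
    · right
      rw [mem_lens₂_iff]
      have hre0 : w.re ≠ 0 := fun h => h0 (Complex.ext (by simpa using h) (by simpa using him))
      have hre1 : w.re ≠ 1 := fun h => h1 (Complex.ext (by simpa using h) (by simpa using him))
      exact ⟨Or.inl (lt_of_le_of_ne hseg.1 (Ne.symm hre0)), Or.inl (lt_of_le_of_ne hseg.2 hre1)⟩
    · exact Or.inl fun h => hseg h.2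
  · exact Or.inl fun h => him h.1

/-- Intersection for two punctures: lens minus segment = off the real line. [folklore] -/
private theorem lens₂_not_seg_iff {w : ℂ} :
    (w ∈ lens₂ ∧ ¬ (w.im = 0 ∧ 0 ≤ w.re ∧ w.re ≤ 1)) ↔ w.im ≠ 0 := by
  rw [mem_lens₂_iff]
  constructor
  · rintro ⟨⟨ha, hb⟩, hs⟩ him
    rcases ha with ha | ha
    · rcases hb with hb | hb
      · exact hs ⟨him, ha.le, hb.le⟩
      · exact hb him
    · exact ha him
  · intro him
    exact ⟨⟨Or.inr him, Or.inr him⟩, fun h => him h.1⟩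

/-- Cover for one puncture: a point other than `0` is off the segment or in the slit plane. [folklore] -/
private theorem not_seg_or_slitPlane {w : ℂ} (h0 : w ≠ 0) :
    ¬ (w.im = 0 ∧ 0 ≤ w.re ∧ w.re ≤ 1) ∨ w ∈ slitPlane := by
  by_cases him : w.im = 0
  · by_cases hre : 0 ≤ w.re
    · right
      rw [mem_slitPlane_iff]
      have hre0 : w.re ≠ 0 := fun h => h0 (Complex.ext (by simpa using h) (by simpa using him))
      exact Or.inl (lt_of_le_of_ne hre (Ne.symm hre0))
    · exact Or.inl fun h => hre h.2.1
  · exact Or.inl fun h => him h.1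

/-- Intersection for one puncture: slit plane minus segment = slit plane beyond `1`. [folklore] -/
private theorem slitPlane_not_seg_iff {w : ℂ} :
    (w ∈ slitPlane ∧ ¬ (w.im = 0 ∧ 0 ≤ w.re ∧ w.re ≤ 1)) ↔ w ∈ lens₁' := by
  rw [mem_slitPlane_iff, mem_lens₁'_iff]
  constructor
  · rintro ⟨ha, hs⟩
    by_cases him : w.im = 0
    · rcases ha with ha | ha
      · left
        by_contra hle
        exact hs ⟨him, ha.le, not_lt.1 hle⟩
      · exact absurd him ha
    · exact Or.inr him
  · rintro (h | h)
    · exact ⟨Or.inl (zero_lt_one.trans h), fun hs => (lt_irrefl _ (h.trans_le hs.2.2)).elim⟩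
    · exact ⟨Or.inr h, fun hs => h hs.1⟩

/-- Helper. [folklore] -/
private theorem zero_not_mem_slitPlane' : (0 : ℂ) ∉ slitPlane := by
  simp [mem_slitPlane_iff]

/-- Helper. [folklore] -/
private theorem zero_not_mem_lens₂ : (0 : ℂ) ∉ lens₂ := fun h => zero_not_mem_slitPlane' h.1

/-- Helper. [folklore] -/
private theorem one_not_mem_lens₂ : (1 : ℂ) ∉ lens₂ := fun h => zero_not_mem_slitPlane' (by
  simpa using h.2)

/-! #### The base points `w₀ = 1/2 + i/4`, `w₀' = 1/2 - i/4`, `w₁ = -1/4` and the unit disc -/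

/-- `1/2 + i/4`. [folklore] -/
private def w₀ : ℂ := ⟨1 / 2, 1 / 4⟩
/-- `1/2 - i/4`. [folklore] -/
private def w₀' : ℂ := ⟨1 / 2, -(1 / 4)⟩
/-- `-1/4`. [folklore] -/
private def w₁ : ℂ := ⟨-(1 / 4), 0⟩

/-- Helper. [folklore] -/
private theorem w₀_re : w₀.re = 1 / 2 := rfl
/-- Helper. [folklore] -/
private theorem w₀_im : w₀.im = 1 / 4 := rfl
/-- Helper. [folklore] -/
private theorem w₀'_re : w₀'.re = 1 / 2 := rfl
/-- Helper. [folklore] -/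
private theorem w₀'_im : w₀'.im = -(1 / 4) := rfl
/-- Helper. [folklore] -/
private theorem w₁_re : w₁.re = -(1 / 4) := rfl
/-- Helper. [folklore] -/
private theorem w₁_im : w₁.im = 0 := rfl

/-- Helper. [folklore] -/
private theorem norm_le_one_of_abs_le {w : ℂ} (hre : |w.re| ≤ 1 / 2) (him : |w.im| ≤ 1 / 4) :
    ‖w‖ ≤ 1 :=
  (Complex.norm_le_abs_re_add_abs_im w).trans (by linarith)

/-- Points with `‖w‖ ≤ 1` land in the chart ball `B(z_a, R)` as soon as `z_b` does. [folklore] -/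
private theorem pt_mem_ball {R : ℝ} (hbR : zb ∈ ball za R) {w : ℂ} (hw : ‖w‖ ≤ 1) :
    pt za zb w ∈ ball za R := by
  rw [mem_ball, dist_eq_norm] at hbR ⊢
  simp only [pt, add_sub_cancel_left, norm_mul]
  calc ‖w‖ * ‖zb - za‖ ≤ 1 * ‖zb - za‖ := by gcongr
    _ = ‖zb - za‖ := one_mul _
    _ < R := hbR

end Plane

/-! ### §2 Straight chart paths -/

section Paths

variable {Y : Type*} [TopologicalSpace Y]

/-- The straight segment from `z₁` to `z₂` in `ℂ` as a path. [folklore] -/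
private def linePath (z₁ z₂ : ℂ) : Path z₁ z₂ where
  toFun t := z₁ + ((t : ℝ) : ℂ) * (z₂ - z₁)
  continuous_toFun := by fun_prop
  source' := by simp
  target' := by simp

/-- Helper. [folklore] -/
private theorem linePath_apply (z₁ z₂ : ℂ) (t : I) :
    linePath z₁ z₂ t = z₁ + ((t : ℝ) : ℂ) * (z₂ - z₁) := rfl

/-- A straight segment lies in any convex set containing its end points. [folklore] -/
private theorem linePath_mem_of_convex {C : Set ℂ} (hC : Convex ℝ C) {z₁ z₂ : ℂ} (h₁ : z₁ ∈ C)
    (h₂ : z₂ ∈ C) (t : I) : linePath z₁ z₂ t ∈ C := by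
  have := hC.segment_subset h₁ h₂
  rw [segment_eq_image'] at this
  refine this ⟨t, ⟨t.2.1, t.2.2⟩, ?_⟩
  simp [linePath_apply, Complex.real_smul]

/-- A path in the chart target, transported to `Y` by the inverse chart. [folklore] -/
private def chartPath (e : OpenPartialHomeomorph Y ℂ) {z₁ z₂ : ℂ} (γ : Path z₁ z₂)
    (hγ : ∀ t, γ t ∈ e.target) : Path (e.symm z₁) (e.symm z₂) where
  toFun t := e.symm (γ t)
  continuous_toFun := e.continuousOn_symm.comp_continuous γ.continuous hγ
  source' := by simp
  target' := by simp

/-- Helper. [folklore] -/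
private theorem chartPath_apply (e : OpenPartialHomeomorph Y ℂ) {z₁ z₂ : ℂ} (γ : Path z₁ z₂)
    (hγ : ∀ t, γ t ∈ e.target) (t : I) : chartPath e γ hγ t = e.symm (γ t) := rfl

end Paths

/-! ### §3 The chart pieces -/

section Chart

variable {Y : Type*} [TopologicalSpace Y] {e : OpenPartialHomeomorph Y ℂ}
  {S : Set Y} {a b : Y} {R : ℝ}

/-- Pull-back of a planar set by the chart. [folklore] -/
private def pre (e : OpenPartialHomeomorph Y ℂ) (A : Set ℂ) : Set Y := e.source ∩ e ⁻¹' A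

/-- Helper. [folklore] -/
private theorem mem_pre {A : Set ℂ} {y : Y} : y ∈ pre e A ↔ y ∈ e.source ∧ e y ∈ A := Iff.rfl

/-- Helper. [folklore] -/
private theorem isOpen_pre {A : Set ℂ} (hA : IsOpen A) : IsOpen (pre e A) :=
  e.isOpen_inter_preimage hA

/-- Helper. [folklore] -/
private theorem symm_mem_pre {A : Set ℂ} (hA : A ⊆ e.target) {z : ℂ} (hz : z ∈ A) :
    e.symm z ∈ pre e A :=
  ⟨e.map_target (hA hz), by show e (e.symm z) ∈ A; rw [e.right_inv (hA hz)]; exact hz⟩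

/-- `e⁻¹(A) ≃ A` for `A ⊆ e.target`. [folklore] -/
private def preHomeomorph (e : OpenPartialHomeomorph Y ℂ) (A : Set ℂ) (hA : A ⊆ e.target) :
    ↥(pre e A) ≃ₜ ↥A where
  toFun y := ⟨e y, y.2.2⟩
  invFun z := ⟨e.symm z, symm_mem_pre hA z.2⟩
  left_inv y := Subtype.ext (e.left_inv y.2.1)
  right_inv z := Subtype.ext (e.right_inv (hA z.2))
  continuous_toFun :=
    (e.continuousOn.comp_continuous continuous_subtype_val fun y => y.2.1).subtype_mk _
  continuous_invFun :=
    (e.continuousOn_symm.comp_continuous continuous_subtype_val fun z => hA z.2).subtype_mk _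

/-- A star-shaped planar piece pulls back to a simply connected subset of `Y`. [folklore] -/
private theorem isSimplyConnected_pre {A : Set ℂ} (hA : A ⊆ e.target) {c : ℂ} (hc : c ∈ A)
    (h : StarConvex ℝ c A) : IsSimplyConnected (pre e A) := by
  haveI : ContractibleSpace ↥A := h.contractibleSpace ⟨c, hc⟩
  haveI : SimplyConnectedSpace ↥A := inferInstance
  exact (preHomeomorph e A hA).toHomotopyEquiv.simplyConnectedSpace_iff.2 inferInstance

/-- Simple connectivity of `A ⊆ P` is the same in `Y` and in the subtype `P` (the tree's
`isSimplyConnected_preimage_val`, inlined to keep imports light). [folklore] -/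
private theorem isSimplyConnected_preimage_val' {P A : Set Y} (hAP : A ⊆ P)
    (hA : IsSimplyConnected A) : IsSimplyConnected (((↑) : P → Y) ⁻¹' A) := by
  rw [← Topology.IsEmbedding.subtypeVal.isSimplyConnected_image, Subtype.image_preimage_coe,
    inter_eq_right.2 hAP]
  exact hA

/-! #### The data and the pieces -/

variable (e a b R) in
/-- The chart ball `E = B(e a, R)` in `Y`-coordinates is `pre e (ball (e a) R)`; the chart segment. [folklore] -/
private def seg : Set Y := pre e (segment ℝ (e a) (e b))

/-- The chart segment is `e.symm '' [e a, e b]`, hence compact and closed. [folklore] -/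
private theorem isClosed_seg [T2Space Y] (hER : ball (e a) R ⊆ e.target)
    (hbR : e b ∈ ball (e a) R) : IsClosed (seg e a b) := by
  have hsub : segment ℝ (e a) (e b) ⊆ e.target :=
    ((convex_ball (e a) R).segment_subset (mem_ball_self (by
      have := (mem_ball.1 hbR); exact lt_of_le_of_lt dist_nonneg this)) hbR).trans hER
  have : seg e a b = e.symm '' segment ℝ (e a) (e b) :=
    (e.symm_image_eq_source_inter_preimage hsub).symm
  rw [this]
  have hc : IsCompact (segment ℝ (e a) (e b)) := by
    rw [segment_eq_image']
    exact isCompact_Icc.image (by fun_prop)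
  exact ((hc.image_of_continuousOn (e.continuousOn_symm.mono hsub)).isClosed)

/-- Helper. [folklore] -/
private theorem mem_seg_iff (hab : e a ≠ e b) {y : Y} :
    y ∈ seg e a b ↔ y ∈ e.source ∧ ((coord (e a) (e b) (e y)).im = 0 ∧
      0 ≤ (coord (e a) (e b) (e y)).re ∧ (coord (e a) (e b) (e y)).re ≤ 1) := by
  rw [seg, mem_pre, mem_segment_iff hab]

/-- Helper. [folklore] -/
private theorem left_mem_seg (ha : a ∈ e.source) : a ∈ seg e a b :=
  ⟨ha, left_mem_segment ℝ _ _⟩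

/-- Helper. [folklore] -/
private theorem right_mem_seg (hb : b ∈ e.source) : b ∈ seg e a b :=
  ⟨hb, right_mem_segment ℝ _ _⟩

/-- Planar lens pieces intersected with the chart ball, pulled back to `Y`. [folklore] -/
private def piece (e : OpenPartialHomeomorph Y ℂ) (a b : Y) (R : ℝ) (A : Set ℂ) : Set Y :=
  pre e (ball (e a) R ∩ coord (e a) (e b) ⁻¹' A)

/-- Helper. [folklore] -/
private theorem mem_piece {A : Set ℂ} {y : Y} :
    y ∈ piece e a b R A ↔ y ∈ e.source ∧ e y ∈ ball (e a) R ∧ coord (e a) (e b) (e y) ∈ A := by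
  simp only [piece, mem_pre, mem_inter_iff, mem_preimage]

/-- Helper. [folklore] -/
private theorem isOpen_piece {A : Set ℂ} (hA : IsOpen A) : IsOpen (piece e a b R A) :=
  isOpen_pre (isOpen_ball.inter (hA.preimage (continuous_coord _ _)))

/-- Helper. [folklore] -/
private theorem piece_subset_ball (A : Set ℂ) : piece e a b R A ⊆ pre e (ball (e a) R) :=
  fun _ h => ⟨h.1, h.2.1⟩

/-- A piece whose planar model is star-shaped about the coordinate of a point of the piece is simply
connected. [folklore] -/
private theorem isSimplyConnected_piece (hER : ball (e a) R ⊆ e.target) {A : Set ℂ} {c : ℂ}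
    (hcE : pt (e a) (e b) c ∈ ball (e a) R) (hcA : c ∈ A) (hab : e a ≠ e b)
    (h : StarConvex ℝ c A) : IsSimplyConnected (piece e a b R A) := by
  refine isSimplyConnected_pre (inter_subset_left.trans hER) (c := pt (e a) (e b) c)
    ⟨hcE, by rw [mem_preimage, coord_pt hab]; exact hcA⟩ ?_
  refine ((convex_ball (e a) R).starConvex hcE).inter ?_
  exact starConvex_preimage_coord (by rw [coord_pt hab]; exact h)

/-- Helper. [folklore] -/
private theorem isPathConnected_piece (hER : ball (e a) R ⊆ e.target) {A : Set ℂ} {c : ℂ}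
    (hcE : pt (e a) (e b) c ∈ ball (e a) R) (hcA : c ∈ A) (hab : e a ≠ e b)
    (h : StarConvex ℝ c A) : IsPathConnected (piece e a b R A) :=
  (isSimplyConnected_piece hER hcE hcA hab h).isPathConnected

/-- Disjointness of the other punctures from the chart ball, pointwise. [folklore] -/
private theorem not_mem_S_of_mem_piece (hS : Disjoint S (e.source ∩ e ⁻¹' ball (e a) R))
    {A : Set ℂ} {y : Y} (hy : y ∈ piece e a b R A) : y ∉ S :=
  fun hyS => hS.le_bot ⟨hyS, piece_subset_ball A hy⟩

/-- The segment lies in the chart ball. [folklore] -/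
private theorem seg_subset_ball (hbR : e b ∈ ball (e a) R) : seg e a b ⊆ pre e (ball (e a) R) := by
  intro y hy
  refine ⟨hy.1, (convex_ball (e a) R).segment_subset (mem_ball_self ?_) hbR hy.2⟩
  exact lt_of_le_of_lt dist_nonneg (mem_ball.1 hbR)

end Chart

/-! ### §4 The hypotheses, the base points -/

section Setup

variable {Y : Type*} [TopologicalSpace Y] {e : OpenPartialHomeomorph Y ℂ}
  {S : Set Y} {a b : Y} {R : ℝ}

variable (e S a b R) in
/-- The standing hypotheses of the chart-local computation (a `Prop`-valued record). [folklore] -/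
private structure Good : Prop where
  ha : a ∈ e.source
  hb : b ∈ e.source
  hab : e a ≠ e b
  hER : ball (e a) R ⊆ e.target
  hbR : e b ∈ ball (e a) R
  hS : IsClosed S
  hSE : Disjoint S (e.source ∩ e ⁻¹' ball (e a) R)
  hU : IsPathConnected (S ∪ seg e a b)ᶜ

/-- The chart base point `e⁻¹(z_a + (1/2 + i/4)(z_b - z_a))`. [folklore] -/
private def x₀ (e : OpenPartialHomeomorph Y ℂ) (a b : Y) : Y := e.symm (pt (e a) (e b) w₀)

/-- The auxiliary point `e⁻¹(z_a + (1/2 - i/4)(z_b - z_a))` in the lower half lens. [folklore] -/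
private def c₂ (e : OpenPartialHomeomorph Y ℂ) (a b : Y) : Y := e.symm (pt (e a) (e b) w₀')

/-- Helper. [folklore] -/
private theorem w₀_norm_le : ‖w₀‖ ≤ 1 :=
  norm_le_one_of_abs_le (by rw [w₀]; norm_num [abs_of_pos]) (by rw [w₀]; norm_num [abs_of_pos])

/-- Helper. [folklore] -/
private theorem w₀'_norm_le : ‖w₀'‖ ≤ 1 :=
  norm_le_one_of_abs_le (by rw [w₀']; norm_num [abs_of_pos]) (by rw [w₀']; norm_num [abs_of_neg])

/-- Helper. [folklore] -/
private theorem w₁_norm_le : ‖w₁‖ ≤ 1 :=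
  norm_le_one_of_abs_le (by rw [w₁]; norm_num [abs_of_neg]) (by rw [w₁]; norm_num)

/-- Helper. [folklore] -/
private theorem half_norm_le : ‖((1 / 2 : ℝ) : ℂ)‖ ≤ 1 := by
  rw [Complex.norm_real]; norm_num

/-- Helper. [folklore] -/
private theorem not_segCond_w₀ : ¬ (w₀.im = 0 ∧ 0 ≤ w₀.re ∧ w₀.re ≤ 1) := by norm_num [w₀]
/-- Helper. [folklore] -/
private theorem not_segCond_w₀' : ¬ (w₀'.im = 0 ∧ 0 ≤ w₀'.re ∧ w₀'.re ≤ 1) := by norm_num [w₀']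
/-- Helper. [folklore] -/
private theorem not_segCond_w₁ : ¬ (w₁.im = 0 ∧ 0 ≤ w₁.re ∧ w₁.re ≤ 1) := by norm_num [w₁]
/-- Helper. [folklore] -/
private theorem w₀_mem_lens₂ : w₀ ∈ lens₂ := by rw [mem_lens₂_iff]; norm_num [w₀]
/-- Helper. [folklore] -/
private theorem w₀_im_pos : 0 < w₀.im := by norm_num [w₀]
/-- Helper. [folklore] -/
private theorem w₀'_im_neg : w₀'.im < 0 := by norm_num [w₀']
/-- Helper. [folklore] -/
private theorem half_mem_lens₂ : ((1 / 2 : ℝ) : ℂ) ∈ lens₂ := by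
  rw [mem_lens₂_iff]; norm_num
/-- Helper. [folklore] -/
private theorem half_mem_slitPlane : ((1 / 2 : ℝ) : ℂ) ∈ slitPlane := by
  rw [mem_slitPlane_iff]; norm_num
/-- Helper. [folklore] -/
private theorem w₀_mem_slitPlane : w₀ ∈ slitPlane := by rw [mem_slitPlane_iff]; norm_num [w₀]
/-- Helper. [folklore] -/
private theorem w₀_mem_lens₁' : w₀ ∈ lens₁' := by rw [mem_lens₁'_iff]; norm_num [w₀]

/-- Coordinates of a point of the form `e.symm (pt w)` with `‖w‖ ≤ 1`. [folklore] -/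
private theorem symm_pt_mem_piece_iff (h : Good e S a b R) {w : ℂ} (hw : ‖w‖ ≤ 1) {A : Set ℂ} :
    e.symm (pt (e a) (e b) w) ∈ piece e a b R A ↔ w ∈ A := by
  have hE := pt_mem_ball h.hbR hw
  rw [mem_piece, e.right_inv (h.hER hE), coord_pt h.hab]
  exact ⟨fun h' => h'.2.2, fun h' => ⟨e.map_target (h.hER hE), hE, h'⟩⟩

/-- Helper. [folklore] -/
private theorem symm_pt_not_mem_seg (h : Good e S a b R) {w : ℂ} (hw : ‖w‖ ≤ 1)
    (hws : ¬ (w.im = 0 ∧ 0 ≤ w.re ∧ w.re ≤ 1)) : e.symm (pt (e a) (e b) w) ∉ seg e a b := by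
  rw [mem_seg_iff h.hab, e.right_inv (h.hER (pt_mem_ball h.hbR hw)), coord_pt h.hab]
  exact fun h' => hws h'.2

/-- Helper. [folklore] -/
private theorem symm_pt_not_mem_S (h : Good e S a b R) {w : ℂ} (hw : ‖w‖ ≤ 1) :
    e.symm (pt (e a) (e b) w) ∉ S := by
  intro h'
  have hE := pt_mem_ball h.hbR hw
  refine h.hSE.le_bot ⟨h', e.map_target (h.hER hE), ?_⟩
  show e (e.symm (pt (e a) (e b) w)) ∈ ball (e a) R
  rw [e.right_inv (h.hER hE)]; exact hE

/-- Helper. [folklore] -/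
private theorem symm_pt_mem_compl (h : Good e S a b R) {w : ℂ} (hw : ‖w‖ ≤ 1)
    (hws : ¬ (w.im = 0 ∧ 0 ≤ w.re ∧ w.re ≤ 1)) : e.symm (pt (e a) (e b) w) ∈ (S ∪ seg e a b)ᶜ := by
  rw [mem_compl_iff, mem_union, not_or]
  exact ⟨symm_pt_not_mem_S h hw, symm_pt_not_mem_seg h hw hws⟩

/-- A point of the segment other than `a`, `b` has coordinate `≠ 0, 1`. [folklore] -/
private theorem coord_ne_zero_of_ne (h : Good e S a b R) {y : Y} (hy : y ∈ e.source) (hya : y ≠ a) :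
    coord (e a) (e b) (e y) ≠ 0 := by
  intro h0
  apply hya
  have : e y = e a := by
    have := congrArg (pt (e a) (e b)) h0
    rwa [pt_coord h.hab, pt, zero_mul, add_zero] at this
  exact e.injOn hy h.ha this

/-- Helper. [folklore] -/
private theorem coord_ne_one_of_ne (h : Good e S a b R) {y : Y} (hy : y ∈ e.source) (hyb : y ≠ b) :
    coord (e a) (e b) (e y) ≠ 1 := by
  intro h1
  apply hyb
  have : e y = e b := by
    have := congrArg (pt (e a) (e b)) h1
    rwa [pt_coord h.hab, pt, one_mul, add_sub_cancel] at this
  exact e.injOn hy h.hb this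

/-- The complement of `S ∪ K` avoids `a` and `b`. [folklore] -/
private theorem compl_subset_P₂ (h : Good e S a b R) : (S ∪ seg e a b)ᶜ ⊆ (insert a (insert b S))ᶜ := by
  intro y hy
  simp only [mem_compl_iff, mem_union, not_or] at hy
  simp only [mem_compl_iff, mem_insert_iff, not_or]
  exact ⟨fun hya => hy.2 (by rw [hya]; exact left_mem_seg h.ha),
    fun hyb => hy.2 (by rw [hyb]; exact right_mem_seg h.hb), hy.1⟩

/-- Helper. [folklore] -/
private theorem compl_subset_P₁ (h : Good e S a b R) : (S ∪ seg e a b)ᶜ ⊆ (insert a S)ᶜ := by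
  intro y hy
  simp only [mem_compl_iff, mem_union, not_or] at hy
  simp only [mem_compl_iff, mem_insert_iff, not_or]
  exact ⟨fun hya => hy.2 (by rw [hya]; exact left_mem_seg h.ha), hy.1⟩

/-- Pieces avoid `S`, `a` (and `b` when their model avoids `1`). [folklore] -/
private theorem piece_subset_P₁ (h : Good e S a b R) {A : Set ℂ} (hA0 : (0 : ℂ) ∉ A) :
    piece e a b R A ⊆ (insert a S)ᶜ := by
  intro y hy
  simp only [mem_compl_iff, mem_insert_iff, not_or]
  refine ⟨fun hya => hA0 ?_, not_mem_S_of_mem_piece h.hSE hy⟩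
  have := (mem_piece.1 hy).2.2
  rwa [hya, coord_self_left] at this

/-- Helper. [folklore] -/
private theorem piece_subset_P₂ (h : Good e S a b R) {A : Set ℂ} (hA0 : (0 : ℂ) ∉ A) (hA1 : (1 : ℂ) ∉ A) :
    piece e a b R A ⊆ (insert a (insert b S))ᶜ := by
  intro y hy
  simp only [mem_compl_iff, mem_insert_iff, not_or]
  refine ⟨fun hya => hA0 ?_, fun hyb => hA1 ?_, not_mem_S_of_mem_piece h.hSE hy⟩
  · have := (mem_piece.1 hy).2.2
    rwa [hya, coord_self_left] at this
  · have := (mem_piece.1 hy).2.2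
    rwa [hyb, coord_self_right h.hab] at this

/-! #### Straight chart paths between points `e.symm (pt w)` -/

/-- `pt` is affine: chart-coordinate segments are straight segments. [folklore] -/
private theorem linePath_pt (za zb w₁ w₂ : ℂ) (t : I) :
    linePath (pt za zb w₁) (pt za zb w₂) t = pt za zb (linePath w₁ w₂ t) := by
  rw [linePath_apply, linePath_apply, pt, pt, pt]; ring

/-- The straight chart path from `e.symm (pt u)` to `e.symm (pt u')`. [folklore] -/
private def segPath (h : Good e S a b R) (u u' : ℂ) (hu : ‖u‖ ≤ 1) (hu' : ‖u'‖ ≤ 1) :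
    Path (e.symm (pt (e a) (e b) u)) (e.symm (pt (e a) (e b) u')) :=
  chartPath e (linePath (pt (e a) (e b) u) (pt (e a) (e b) u')) fun t => h.hER
    (linePath_mem_of_convex (convex_ball _ _) (pt_mem_ball h.hbR hu) (pt_mem_ball h.hbR hu') t)

/-- Helper. [folklore] -/
private theorem segPath_apply (h : Good e S a b R) (u u' : ℂ) (hu : ‖u‖ ≤ 1) (hu' : ‖u'‖ ≤ 1)
    (t : I) : segPath h u u' hu hu' t = e.symm (pt (e a) (e b) (linePath u u' t)) := by
  rw [segPath, chartPath_apply, linePath_pt]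

/-- Real and imaginary parts along a straight segment. [folklore] -/
private theorem linePath_re_im (u u' : ℂ) (t : I) :
    (linePath u u' t).re = u.re + (t : ℝ) * (u'.re - u.re) ∧
      (linePath u u' t).im = u.im + (t : ℝ) * (u'.im - u.im) := by
  simp [linePath_apply]

end Setup

/-! ### §5 Two punctures: the HNN form of van Kampen's theorem -/

section TwoPunctures

variable {Y : Type*} [TopologicalSpace Y] {e : OpenPartialHomeomorph Y ℂ}
  {S : Set Y} {a b : Y} {R : ℝ}

/-- `Y ∖ (S ∪ {a, b})`. [folklore] -/
private def P₂ (S : Set Y) (a b : Y) : Set Y := (insert a (insert b S))ᶜ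

/-- `U = Y ∖ (S ∪ K)` as a subset of `Y ∖ (S ∪ {a, b})`. [folklore] -/
private def U₂ (e : OpenPartialHomeomorph Y ℂ) (S : Set Y) (a b : Y) : Set ↥(P₂ S a b) :=
  Subtype.val ⁻¹' (S ∪ seg e a b)ᶜ

/-- The twice-slit lens `T` as a subset of `Y ∖ (S ∪ {a, b})`. [folklore] -/
private def T₂ (e : OpenPartialHomeomorph Y ℂ) (S : Set Y) (a b : Y) (R : ℝ) : Set ↥(P₂ S a b) :=
  Subtype.val ⁻¹' piece e a b R lens₂

/-- The upper half lens `C₁`. [folklore] -/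
private def Cp (e : OpenPartialHomeomorph Y ℂ) (S : Set Y) (a b : Y) (R : ℝ) : Set ↥(P₂ S a b) :=
  Subtype.val ⁻¹' piece e a b R {w | 0 < w.im}

/-- The lower half lens `C₂`. [folklore] -/
private def Cm (e : OpenPartialHomeomorph Y ℂ) (S : Set Y) (a b : Y) (R : ℝ) : Set ↥(P₂ S a b) :=
  Subtype.val ⁻¹' piece e a b R {w | w.im < 0}

/-- Helper. [folklore] -/
private theorem x₀_mem_P₂ (h : Good e S a b R) : x₀ e a b ∈ P₂ S a b :=
  compl_subset_P₂ h (symm_pt_mem_compl h w₀_norm_le not_segCond_w₀)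

/-- Helper. [folklore] -/
private theorem c₂_mem_P₂ (h : Good e S a b R) : c₂ e a b ∈ P₂ S a b :=
  compl_subset_P₂ h (symm_pt_mem_compl h w₀'_norm_le not_segCond_w₀')

/-- Helper. [folklore] -/
private theorem isOpen_U₂ [T2Space Y] (h : Good e S a b R) : IsOpen (U₂ e S a b) :=
  (h.hS.union (isClosed_seg h.hER h.hbR)).isOpen_compl.preimage continuous_subtype_val

/-- Helper. [folklore] -/
private theorem isOpen_T₂ : IsOpen (T₂ e S a b R) :=
  (isOpen_piece isOpen_lens₂).preimage continuous_subtype_val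

/-- Helper. [folklore] -/
private theorem isOpen_Cp : IsOpen (Cp e S a b R) :=
  (isOpen_piece (isOpen_lt continuous_const Complex.continuous_im)).preimage continuous_subtype_val

/-- Helper. [folklore] -/
private theorem isOpen_Cm : IsOpen (Cm e S a b R) :=
  (isOpen_piece (isOpen_lt Complex.continuous_im continuous_const)).preimage continuous_subtype_val

/-- Helper. [folklore] -/
private theorem U₂_union_T₂ (h : Good e S a b R) : U₂ e S a b ∪ T₂ e S a b R = univ := by
  refine eq_univ_of_forall fun y => ?_
  by_cases hy : (y : Y) ∈ S ∪ seg e a b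
  · right
    have hyP : (y : Y) ∈ P₂ S a b := y.2
    simp only [P₂, mem_compl_iff, mem_insert_iff, not_or] at hyP
    rcases hy with hyS | hyK
    · exact absurd hyS hyP.2.2
    · have hys : (y : Y) ∈ e.source := hyK.1
      have hc := ((mem_seg_iff h.hab).1 hyK).2
      rcases not_seg_or_lens₂ (coord_ne_zero_of_ne h hys hyP.1) (coord_ne_one_of_ne h hys hyP.2.1)
        with hn | hl
      · exact absurd hc hn
      · exact ⟨hys, (seg_subset_ball h.hbR hyK).2, hl⟩
  · exact Or.inl hy

/-- Helper. [folklore] -/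
private theorem disjoint_Cp_Cm : Disjoint (Cp e S a b R) (Cm e S a b R) := by
  rw [Set.disjoint_left]
  intro y h1 h2
  have h1' : 0 < (coord (e a) (e b) (e y)).im := (mem_piece.1 h1).2.2
  have h2' : (coord (e a) (e b) (e y)).im < 0 := (mem_piece.1 h2).2.2
  exact lt_asymm h1' h2'

/-- Helper. [folklore] -/
private theorem U₂_inter_T₂ (h : Good e S a b R) : U₂ e S a b ∩ T₂ e S a b R = Cp e S a b R ∪ Cm e S a b R := by
  ext y
  simp only [U₂, T₂, Cp, Cm, mem_inter_iff, mem_union, mem_preimage, mem_compl_iff, not_or]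
  constructor
  · rintro ⟨⟨-, hyK⟩, hyT⟩
    obtain ⟨hys, hyE, hyl⟩ := mem_piece.1 hyT
    have hseg : ¬ ((coord (e a) (e b) (e y)).im = 0 ∧ 0 ≤ (coord (e a) (e b) (e y)).re ∧
        (coord (e a) (e b) (e y)).re ≤ 1) := fun hc => hyK ((mem_seg_iff h.hab).2 ⟨hys, hc⟩)
    have him : (coord (e a) (e b) (e y)).im ≠ 0 := lens₂_not_seg_iff.1 ⟨hyl, hseg⟩
    rcases lt_or_gt_of_ne him with hlt | hgt
    · exact Or.inr (mem_piece.2 ⟨hys, hyE, hlt⟩)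
    · exact Or.inl (mem_piece.2 ⟨hys, hyE, hgt⟩)
  · intro hy
    have hy' : (y : Y) ∈ e.source ∧ e y ∈ ball (e a) R ∧ (coord (e a) (e b) (e y)).im ≠ 0 := by
      rcases hy with hy | hy
      · obtain ⟨hys, hyE, hgt⟩ := mem_piece.1 hy; exact ⟨hys, hyE, ne_of_gt hgt⟩
      · obtain ⟨hys, hyE, hlt⟩ := mem_piece.1 hy; exact ⟨hys, hyE, ne_of_lt hlt⟩
    obtain ⟨hys, hyE, him⟩ := hy'
    obtain ⟨hyl, hseg⟩ := lens₂_not_seg_iff.2 him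
    have hT : (y : Y) ∈ piece e a b R lens₂ := mem_piece.2 ⟨hys, hyE, hyl⟩
    exact ⟨⟨not_mem_S_of_mem_piece h.hSE hT, fun hK => hseg ((mem_seg_iff h.hab).1 hK).2⟩, hT⟩

/-- Helper. [folklore] -/
private theorem x₀_mem_Cp (h : Good e S a b R) : (⟨x₀ e a b, x₀_mem_P₂ h⟩ : ↥(P₂ S a b)) ∈ Cp e S a b R :=
  (symm_pt_mem_piece_iff h w₀_norm_le).2 w₀_im_pos

/-- Helper. [folklore] -/
private theorem x₀_mem_U₂ (h : Good e S a b R) : (⟨x₀ e a b, x₀_mem_P₂ h⟩ : ↥(P₂ S a b)) ∈ U₂ e S a b :=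
  symm_pt_mem_compl h w₀_norm_le not_segCond_w₀

/-- Helper. [folklore] -/
private theorem x₀_mem_T₂ (h : Good e S a b R) : (⟨x₀ e a b, x₀_mem_P₂ h⟩ : ↥(P₂ S a b)) ∈ T₂ e S a b R :=
  (symm_pt_mem_piece_iff h w₀_norm_le).2 w₀_mem_lens₂

/-- Helper. [folklore] -/
private theorem c₂_mem_Cm (h : Good e S a b R) : (⟨c₂ e a b, c₂_mem_P₂ h⟩ : ↥(P₂ S a b)) ∈ Cm e S a b R :=
  (symm_pt_mem_piece_iff h w₀'_norm_le).2 w₀'_im_neg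

/-- Helper. [folklore] -/
private theorem isPathConnected_U₂ (h : Good e S a b R) : IsPathConnected (U₂ e S a b) :=
  h.hU.preimage_coe (compl_subset_P₂ h)

/-- Helper. [folklore] -/
private theorem isSimplyConnected_T₂ (h : Good e S a b R) : IsSimplyConnected (T₂ e S a b R) :=
  isSimplyConnected_preimage_val' (piece_subset_P₂ h zero_not_mem_lens₂ one_not_mem_lens₂)
    (isSimplyConnected_piece h.hER (pt_mem_ball h.hbR half_norm_le) half_mem_lens₂ h.hab
      starConvex_lens₂)

/-- Helper. [folklore] -/
private theorem isSimplyConnected_Cp (h : Good e S a b R) : IsSimplyConnected (Cp e S a b R) :=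
  isSimplyConnected_preimage_val'
    (piece_subset_P₂ h (by simp) (by simp))
    (isSimplyConnected_piece h.hER (pt_mem_ball h.hbR w₀_norm_le) w₀_im_pos h.hab
      (convex_im_pos.starConvex w₀_im_pos))

/-- Helper. [folklore] -/
private theorem isSimplyConnected_Cm (h : Good e S a b R) : IsSimplyConnected (Cm e S a b R) :=
  isSimplyConnected_preimage_val'
    (piece_subset_P₂ h (by simp) (by simp))
    (isSimplyConnected_piece h.hER (pt_mem_ball h.hbR w₀'_norm_le) w₀'_im_neg h.hab
      (convex_im_neg.starConvex w₀'_im_neg))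

/-- The path `η_T` inside the lens: the chart segment from `w₀` to `w₀'` (through `1/2`). [folklore] -/
private theorem exists_ηT (h : Good e S a b R) :
    ∃ η : Path (⟨x₀ e a b, x₀_mem_P₂ h⟩ : ↥(P₂ S a b)) ⟨c₂ e a b, c₂_mem_P₂ h⟩,
      ∀ t, η t ∈ T₂ e S a b R := by
  have hmem : ∀ t : I, linePath w₀ w₀' t ∈ lens₂ ∧ ‖linePath w₀ w₀' t‖ ≤ 1 := by
    intro t
    obtain ⟨hre, him⟩ := linePath_re_im w₀ w₀' t
    have ht0 := t.2.1; have ht1 := t.2.2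
    rw [w₀_re, w₀'_re] at hre; rw [w₀_im, w₀'_im] at him
    refine ⟨?_, norm_le_one_of_abs_le ?_ ?_⟩
    · rw [mem_lens₂_iff, hre]; norm_num
    · rw [hre]; norm_num [abs_of_pos]
    · rw [him, abs_le]; constructor <;> nlinarith
  have hT : ∀ t : I, segPath h w₀ w₀' w₀_norm_le w₀'_norm_le t ∈ piece e a b R lens₂ := fun t => by
    rw [segPath_apply]; exact (symm_pt_mem_piece_iff h (hmem t).2).2 (hmem t).1
  exact ⟨VanKampen.liftPath (P₂ S a b) (segPath h w₀ w₀' w₀_norm_le w₀'_norm_le)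
    fun t => piece_subset_P₂ h zero_not_mem_lens₂ one_not_mem_lens₂ (hT t), hT⟩

/-- The path `η_U` avoiding the segment: the chart polygon `w₀ → -1/4 → w₀'` around `a`. [folklore] -/
private theorem exists_ηU (h : Good e S a b R) :
    ∃ η : Path (⟨x₀ e a b, x₀_mem_P₂ h⟩ : ↥(P₂ S a b)) ⟨c₂ e a b, c₂_mem_P₂ h⟩,
      ∀ t, η t ∈ U₂ e S a b := by
  -- first leg `w₀ → w₁`
  have hmem₁ : ∀ t : I, ¬ ((linePath w₀ w₁ t).im = 0 ∧ 0 ≤ (linePath w₀ w₁ t).re ∧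
      (linePath w₀ w₁ t).re ≤ 1) ∧ ‖linePath w₀ w₁ t‖ ≤ 1 := by
    intro t
    obtain ⟨hre, him⟩ := linePath_re_im w₀ w₁ t
    have ht0 := t.2.1; have ht1 := t.2.2
    rw [w₀_re, w₁_re] at hre; rw [w₀_im, w₁_im] at him
    refine ⟨?_, norm_le_one_of_abs_le ?_ ?_⟩
    · rintro ⟨h0, hge, -⟩
      rw [him] at h0; rw [hre] at hge
      have : (t : ℝ) = 1 := by linarith
      rw [this] at hge; norm_num at hge
    · rw [hre, abs_le]; constructor <;> nlinarith
    · rw [him, abs_le]; constructor <;> nlinarith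
  -- second leg `w₁ → w₀'`
  have hmem₂ : ∀ t : I, ¬ ((linePath w₁ w₀' t).im = 0 ∧ 0 ≤ (linePath w₁ w₀' t).re ∧
      (linePath w₁ w₀' t).re ≤ 1) ∧ ‖linePath w₁ w₀' t‖ ≤ 1 := by
    intro t
    obtain ⟨hre, him⟩ := linePath_re_im w₁ w₀' t
    have ht0 := t.2.1; have ht1 := t.2.2
    rw [w₁_re, w₀'_re] at hre; rw [w₁_im, w₀'_im] at him
    refine ⟨?_, norm_le_one_of_abs_le ?_ ?_⟩
    · rintro ⟨h0, hge, -⟩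
      rw [him] at h0; rw [hre] at hge
      have : (t : ℝ) = 0 := by linarith
      rw [this] at hge; norm_num at hge
    · rw [hre, abs_le]; constructor <;> nlinarith
    · rw [him, abs_le]; constructor <;> nlinarith
  have hU₁ : ∀ t : I, segPath h w₀ w₁ w₀_norm_le w₁_norm_le t ∈ (S ∪ seg e a b)ᶜ := fun t => by
    rw [segPath_apply]; exact symm_pt_mem_compl h (hmem₁ t).2 (hmem₁ t).1
  have hU₂ : ∀ t : I, segPath h w₁ w₀' w₁_norm_le w₀'_norm_le t ∈ (S ∪ seg e a b)ᶜ := fun t => by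
    rw [segPath_apply]; exact symm_pt_mem_compl h (hmem₂ t).2 (hmem₂ t).1
  refine ⟨(VanKampen.liftPath (P₂ S a b) (segPath h w₀ w₁ w₀_norm_le w₁_norm_le)
      fun t => compl_subset_P₂ h (hU₁ t)).trans
    (VanKampen.liftPath (P₂ S a b) (segPath h w₁ w₀' w₁_norm_le w₀'_norm_le)
      fun t => compl_subset_P₂ h (hU₂ t)), fun t => ?_⟩
  have ht := (Path.trans_range
    (VanKampen.liftPath (P₂ S a b) (segPath h w₀ w₁ w₀_norm_le w₁_norm_le)
      fun t => compl_subset_P₂ h (hU₁ t))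
    (VanKampen.liftPath (P₂ S a b) (segPath h w₁ w₀' w₁_norm_le w₀'_norm_le)
      fun t => compl_subset_P₂ h (hU₂ t))) ▸ mem_range_self t
  rcases ht with ⟨s, hs⟩ | ⟨s, hs⟩
  · have : (VanKampen.liftPath (P₂ S a b) (segPath h w₀ w₁ w₀_norm_le w₁_norm_le)
        fun t => compl_subset_P₂ h (hU₁ t)) s ∈ U₂ e S a b := hU₁ s
    rwa [hs] at this
  · have : (VanKampen.liftPath (P₂ S a b) (segPath h w₁ w₀' w₁_norm_le w₀'_norm_le)
        fun t => compl_subset_P₂ h (hU₂ t)) s ∈ U₂ e S a b := hU₂ s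
    rwa [hs] at this

/-- `U ⊆ Y ∖ (S ∪ {a,b})` as a space is `Y ∖ (S ∪ K)`. [folklore] -/
private def U₂Homeomorph (h : Good e S a b R) : ↥(U₂ e S a b) ≃ₜ ↥((S ∪ seg e a b)ᶜ) :=
  (subtypeSubtypeHomeomorph (P₂ S a b) fun y => y ∈ (S ∪ seg e a b)ᶜ).trans
    (Homeomorph.setCongr (by
      ext y
      exact ⟨fun hy => hy.2, fun hy => ⟨compl_subset_P₂ h hy, hy⟩⟩))

/-- **Two punctures**: `π₁(Y ∖ (S ∪ {a, b}), x₀) ≅ π₁(Y ∖ (S ∪ K), x₀) ∗ ℤ` (van Kampen, HNN form: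
the pieces `U`, `T` meet in the two half lenses). [cite: HatcherAT2002, §1.2 Thm. 1.20 and §1.B] -/
private theorem two_punctures [T2Space Y] (h : Good e S a b R) :
    Nonempty (_root_.FundamentalGroup ↥(P₂ S a b) ⟨x₀ e a b, x₀_mem_P₂ h⟩ ≃*
      Monoid.Coprod (_root_.FundamentalGroup ↥((S ∪ seg e a b)ᶜ)
        ⟨x₀ e a b, symm_pt_mem_compl h w₀_norm_le not_segCond_w₀⟩) (Multiplicative ℤ)) := by
  obtain ⟨ηU, hηU⟩ := exists_ηU h
  obtain ⟨ηT, hηT⟩ := exists_ηT h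
  have E := VanKampen.fundamentalGroupEquivCoprodInt (isOpen_U₂ h) isOpen_T₂ (U₂_union_T₂ h)
    isOpen_Cp isOpen_Cm disjoint_Cp_Cm (U₂_inter_T₂ h) (x₀_mem_Cp h) (x₀_mem_U₂ h) (x₀_mem_T₂ h)
    (c₂_mem_Cm h) (isPathConnected_U₂ h) (isSimplyConnected_T₂ h) (isSimplyConnected_Cp h)
    (isSimplyConnected_Cm h) ηU hηU ηT hηT
  have F := (U₂Homeomorph h).fundamentalGroupMulEquiv
    (x := ⟨⟨x₀ e a b, x₀_mem_P₂ h⟩, x₀_mem_U₂ h⟩)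
    (y := ⟨x₀ e a b, symm_pt_mem_compl h w₀_norm_le not_segCond_w₀⟩) rfl
  exact ⟨E.trans (MulEquiv.coprodCongr F (MulEquiv.refl _))⟩

/-- `Y ∖ (S ∪ {a, b})` is path connected (it is `U ∪ T`, both path connected, meeting at `x₀`). [folklore] -/
private theorem isPathConnected_P₂ [T2Space Y] (h : Good e S a b R) : IsPathConnected (P₂ S a b) := by
  have hU : IsPathConnected (U₂ e S a b) := isPathConnected_U₂ h
  have hT : IsPathConnected (T₂ e S a b R) := (isSimplyConnected_T₂ h).isPathConnected
  have huniv : IsPathConnected (univ : Set ↥(P₂ S a b)) := by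
    rw [← U₂_union_T₂ h]
    exact hU.union hT ⟨_, x₀_mem_U₂ h, x₀_mem_T₂ h⟩
  rw [isPathConnected_iff_pathConnectedSpace]
  exact pathConnectedSpace_iff_univ.2 huniv

end TwoPunctures

/-! ### §6 One puncture: the free-product form with simply connected intersection -/

section OnePuncture

variable {Y : Type*} [TopologicalSpace Y] {e : OpenPartialHomeomorph Y ℂ}
  {S : Set Y} {a b : Y} {R : ℝ}

/-- `Y ∖ (S ∪ {a})`. [folklore] -/
private def P₁ (S : Set Y) (a : Y) : Set Y := (insert a S)ᶜ

/-- `U = Y ∖ (S ∪ K)` as a subset of `Y ∖ (S ∪ {a})`. [folklore] -/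
private def U₁ (e : OpenPartialHomeomorph Y ℂ) (S : Set Y) (a b : Y) : Set ↥(P₁ S a) :=
  Subtype.val ⁻¹' (S ∪ seg e a b)ᶜ

/-- The slit lens `T'` as a subset of `Y ∖ (S ∪ {a})`. [folklore] -/
private def T₁ (e : OpenPartialHomeomorph Y ℂ) (S : Set Y) (a b : Y) (R : ℝ) : Set ↥(P₁ S a) :=
  Subtype.val ⁻¹' piece e a b R slitPlane

/-- Helper. [folklore] -/
private theorem x₀_mem_P₁ (h : Good e S a b R) : x₀ e a b ∈ P₁ S a :=
  compl_subset_P₁ h (symm_pt_mem_compl h w₀_norm_le not_segCond_w₀)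

/-- Helper. [folklore] -/
private theorem isOpen_U₁ [T2Space Y] (h : Good e S a b R) : IsOpen (U₁ e S a b) :=
  (h.hS.union (isClosed_seg h.hER h.hbR)).isOpen_compl.preimage continuous_subtype_val

/-- Helper. [folklore] -/
private theorem isOpen_T₁ : IsOpen (T₁ e S a b R) :=
  (isOpen_piece isOpen_slitPlane).preimage continuous_subtype_val

/-- Helper. [folklore] -/
private theorem U₁_union_T₁ (h : Good e S a b R) : U₁ e S a b ∪ T₁ e S a b R = univ := by
  refine eq_univ_of_forall fun y => ?_
  by_cases hy : (y : Y) ∈ S ∪ seg e a b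
  · right
    have hyP : (y : Y) ∈ P₁ S a := y.2
    simp only [P₁, mem_compl_iff, mem_insert_iff, not_or] at hyP
    rcases hy with hyS | hyK
    · exact absurd hyS hyP.2
    · have hys : (y : Y) ∈ e.source := hyK.1
      have hc := ((mem_seg_iff h.hab).1 hyK).2
      rcases not_seg_or_slitPlane (coord_ne_zero_of_ne h hys hyP.1) with hn | hl
      · exact absurd hc hn
      · exact ⟨hys, (seg_subset_ball h.hbR hyK).2, hl⟩
  · exact Or.inl hy

/-- `U ∩ T'` is the slit lens beyond `b`. [folklore] -/
private theorem U₁_inter_T₁ (h : Good e S a b R) :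
    U₁ e S a b ∩ T₁ e S a b R = Subtype.val ⁻¹' piece e a b R lens₁' := by
  ext y
  simp only [U₁, T₁, mem_inter_iff, mem_preimage, mem_compl_iff, mem_union, not_or]
  constructor
  · rintro ⟨⟨-, hyK⟩, hyT⟩
    obtain ⟨hys, hyE, hyl⟩ := mem_piece.1 hyT
    have hseg : ¬ ((coord (e a) (e b) (e y)).im = 0 ∧ 0 ≤ (coord (e a) (e b) (e y)).re ∧
        (coord (e a) (e b) (e y)).re ≤ 1) := fun hc => hyK ((mem_seg_iff h.hab).2 ⟨hys, hc⟩)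
    exact mem_piece.2 ⟨hys, hyE, slitPlane_not_seg_iff.1 ⟨hyl, hseg⟩⟩
  · intro hy
    obtain ⟨hys, hyE, hyl⟩ := mem_piece.1 hy
    obtain ⟨hsl, hseg⟩ := slitPlane_not_seg_iff.2 hyl
    have hT : (y : Y) ∈ piece e a b R slitPlane := mem_piece.2 ⟨hys, hyE, hsl⟩
    exact ⟨⟨not_mem_S_of_mem_piece h.hSE hT, fun hK => hseg ((mem_seg_iff h.hab).1 hK).2⟩, hT⟩

/-- Helper. [folklore] -/
private theorem x₀_mem_U₁ (h : Good e S a b R) : (⟨x₀ e a b, x₀_mem_P₁ h⟩ : ↥(P₁ S a)) ∈ U₁ e S a b :=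
  symm_pt_mem_compl h w₀_norm_le not_segCond_w₀

/-- Helper. [folklore] -/
private theorem x₀_mem_T₁ (h : Good e S a b R) : (⟨x₀ e a b, x₀_mem_P₁ h⟩ : ↥(P₁ S a)) ∈ T₁ e S a b R :=
  (symm_pt_mem_piece_iff h w₀_norm_le).2 w₀_mem_slitPlane

/-- Helper. [folklore] -/
private theorem isPathConnected_U₁ (h : Good e S a b R) : IsPathConnected (U₁ e S a b) :=
  h.hU.preimage_coe (compl_subset_P₁ h)

/-- Helper. [folklore] -/
private theorem isSimplyConnected_T₁ (h : Good e S a b R) : IsSimplyConnected (T₁ e S a b R) :=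
  isSimplyConnected_preimage_val' (piece_subset_P₁ h zero_not_mem_slitPlane')
    (isSimplyConnected_piece h.hER (pt_mem_ball h.hbR half_norm_le) half_mem_slitPlane h.hab
      (starConvex_ofReal_slitPlane (by norm_num)))

/-- A point just beyond `b` on the chart line, inside the chart ball: `w = 1 + ε`. [folklore] -/
private theorem exists_center_lens₁' (h : Good e S a b R) :
    ∃ t : ℝ, 0 < t ∧ pt (e a) (e b) ((1 + t : ℝ) : ℂ) ∈ ball (e a) R := by
  have hv : 0 < ‖e b - e a‖ := norm_pos_iff.2 (sub_ne_zero.2 (Ne.symm h.hab))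
  have hbR : ‖e b - e a‖ < R := by
    have := h.hbR; rwa [mem_ball, dist_eq_norm] at this
  refine ⟨(R - ‖e b - e a‖) / (2 * ‖e b - e a‖), div_pos (by linarith) (by linarith), ?_⟩
  rw [mem_ball, dist_eq_norm]
  simp only [pt, add_sub_cancel_left, norm_mul, Complex.norm_real, Real.norm_eq_abs]
  rw [abs_of_pos (by positivity)]
  have : (1 + (R - ‖e b - e a‖) / (2 * ‖e b - e a‖)) * ‖e b - e a‖ = (R + ‖e b - e a‖) / 2 := by
    field_simp; ring
  rw [this]; linarith

/-- Helper. [folklore] -/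
private theorem isSimplyConnected_U₁_inter_T₁ (h : Good e S a b R) :
    IsSimplyConnected (U₁ e S a b ∩ T₁ e S a b R) := by
  rw [U₁_inter_T₁ h]
  obtain ⟨t, ht, htE⟩ := exists_center_lens₁' h
  have hzero : (0 : ℂ) ∉ lens₁' := by rw [mem_lens₁'_iff]; norm_num
  exact isSimplyConnected_preimage_val' (piece_subset_P₁ h hzero)
    (isSimplyConnected_piece h.hER htE
      (by rw [mem_lens₁'_iff]; left; rw [Complex.ofReal_re]; linarith) h.hab
      (starConvex_lens₁' ht))

/-- `U ⊆ Y ∖ (S ∪ {a})` as a space is `Y ∖ (S ∪ K)`. [folklore] -/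
private def U₁Homeomorph (h : Good e S a b R) : ↥(U₁ e S a b) ≃ₜ ↥((S ∪ seg e a b)ᶜ) :=
  (subtypeSubtypeHomeomorph (P₁ S a) fun y => y ∈ (S ∪ seg e a b)ᶜ).trans
    (Homeomorph.setCongr (by
      ext y
      exact ⟨fun hy => hy.2, fun hy => ⟨compl_subset_P₁ h hy, hy⟩⟩))

/-- **One puncture**: `π₁(Y ∖ (S ∪ {a}), x₀) ≅ π₁(Y ∖ (S ∪ K), x₀)` (van Kampen with the simply
connected slit lens `T'` and simply connected intersection). [cite: HatcherAT2002, §1.2 Thm. 1.20] -/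
private theorem one_puncture [T2Space Y] (h : Good e S a b R) :
    Nonempty (_root_.FundamentalGroup ↥(P₁ S a) ⟨x₀ e a b, x₀_mem_P₁ h⟩ ≃*
      _root_.FundamentalGroup ↥((S ∪ seg e a b)ᶜ)
        ⟨x₀ e a b, symm_pt_mem_compl h w₀_norm_le not_segCond_w₀⟩) := by
  have E := VanKampen.fundamentalGroupEquivCoprod (isOpen_U₁ h) isOpen_T₁ (U₁_union_T₁ h)
    (x₀_mem_U₁ h) (x₀_mem_T₁ h) (isPathConnected_U₁ h) (isSimplyConnected_T₁ h).isPathConnected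
    (isSimplyConnected_U₁_inter_T₁ h)
  haveI : SimplyConnectedSpace ↥(T₁ e S a b R) := (isSimplyConnected_T₁ h).simplyConnectedSpace
  letI : Unique (_root_.FundamentalGroup ↥(T₁ e S a b R) ⟨⟨x₀ e a b, x₀_mem_P₁ h⟩, x₀_mem_T₁ h⟩) :=
    uniqueOfSubsingleton 1
  have F := (U₁Homeomorph h).fundamentalGroupMulEquiv
    (x := ⟨⟨x₀ e a b, x₀_mem_P₁ h⟩, x₀_mem_U₁ h⟩)
    (y := ⟨x₀ e a b, symm_pt_mem_compl h w₀_norm_le not_segCond_w₀⟩) rfl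
  exact ⟨(E.trans (MulEquiv.coprodCongr F (MulEquiv.ofUnique (N := PUnit.{1})))).trans
    (MulEquiv.coprodPUnit _)⟩

/-- `Y ∖ (S ∪ {a})` is path connected. [folklore] -/
private theorem isPathConnected_P₁ [T2Space Y] (h : Good e S a b R) : IsPathConnected (P₁ S a) := by
  have hU : IsPathConnected (U₁ e S a b) := isPathConnected_U₁ h
  have hT : IsPathConnected (T₁ e S a b R) := (isSimplyConnected_T₁ h).isPathConnected
  have huniv : IsPathConnected (univ : Set ↥(P₁ S a)) := by
    rw [← U₁_union_T₁ h]
    exact hU.union hT ⟨_, x₀_mem_U₁ h, x₀_mem_T₁ h⟩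
  rw [isPathConnected_iff_pathConnectedSpace]
  exact pathConnectedSpace_iff_univ.2 huniv

end OnePuncture

/-! ### §7 The theorem -/

section Main

variable {Y : Type*} [TopologicalSpace Y] [T2Space Y] {e : OpenPartialHomeomorph Y ℂ}
  {S : Set Y} {a b : Y} {R : ℝ}

omit [T2Space Y] in
/-- Helper: the hypotheses packaged. [folklore] -/
private theorem good (ha : a ∈ e.source) (hb : b ∈ e.source) (hab : a ≠ b)
    (hER : ball (e a) R ⊆ e.target) (hbR : e b ∈ ball (e a) R) (hS : IsClosed S)
    (hSE : Disjoint S (e.source ∩ e ⁻¹' ball (e a) R))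
    (hU : IsPathConnected (S ∪ (e.source ∩ e ⁻¹' segment ℝ (e a) (e b)))ᶜ) : Good e S a b R :=
  ⟨ha, hb, fun h => hab (e.injOn ha hb h), hER, hbR, hS, hSE, hU⟩

/-- **`Y ∖ (S ∪ {a, b})` is path connected** under the hypotheses of the theorem (it is the union of
the path connected `Y ∖ (S ∪ K)` and the twice-slit chart lens). [cite: HatcherAT2002, §1.2 Example 1.22 (setting)] -/
theorem isPathConnected_compl_insert_insert (ha : a ∈ e.source) (hb : b ∈ e.source) (hab : a ≠ b)
    (hER : ball (e a) R ⊆ e.target) (hbR : e b ∈ ball (e a) R) (hS : IsClosed S)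
    (hSE : Disjoint S (e.source ∩ e ⁻¹' ball (e a) R))
    (hU : IsPathConnected (S ∪ (e.source ∩ e ⁻¹' segment ℝ (e a) (e b)))ᶜ) :
    IsPathConnected (insert a (insert b S))ᶜ :=
  isPathConnected_P₂ (good ha hb hab hER hbR hS hSE hU)

/-- **`Y ∖ (S ∪ {a})` is path connected** under the hypotheses of the theorem.
[cite: HatcherAT2002, §1.2 Example 1.22 (setting)] -/
theorem isPathConnected_compl_insert (ha : a ∈ e.source) (hb : b ∈ e.source) (hab : a ≠ b)
    (hER : ball (e a) R ⊆ e.target) (hbR : e b ∈ ball (e a) R) (hS : IsClosed S)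
    (hSE : Disjoint S (e.source ∩ e ⁻¹' ball (e a) R))
    (hU : IsPathConnected (S ∪ (e.source ∩ e ⁻¹' segment ℝ (e a) (e b)))ᶜ) :
    IsPathConnected (insert a S)ᶜ :=
  isPathConnected_P₁ (good ha hb hab hER hbR hS hSE hU)

/-- **Two punctures in one chart add a free factor `ℤ`**: for a Hausdorff space `Y`, a chart
`e : Y ⇀ ℂ`, points `a ≠ b` of its source with `e b` in a chart ball `B(e a, R) ⊆ e.target`, a closed
set `S` of further punctures off the chart ball, and `Y ∖ (S ∪ e⁻¹[e a, e b])` path connected,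
`π₁(Y ∖ (S ∪ {a, b}), x) ≅ π₁(Y ∖ (S ∪ {a}), y) ∗ ℤ` for all base points `x`, `y` (Hatcher, Example
1.22: a surface punctured once more has fundamental group enlarged by a free factor `ℤ`; proved here
by the Seifert–van Kampen theorem in its HNN / two-component form and its free-product form).
[cite: HatcherAT2002, §1.2 Thm. 1.20, Example 1.22; §1.B] -/
theorem nonempty_mulEquiv_coprod_int (ha : a ∈ e.source) (hb : b ∈ e.source) (hab : a ≠ b)
    (hER : ball (e a) R ⊆ e.target) (hbR : e b ∈ ball (e a) R) (hS : IsClosed S)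
    (hSE : Disjoint S (e.source ∩ e ⁻¹' ball (e a) R))
    (hU : IsPathConnected (S ∪ (e.source ∩ e ⁻¹' segment ℝ (e a) (e b)))ᶜ)
    (x : ↥((insert a (insert b S))ᶜ : Set Y)) (y : ↥((insert a S)ᶜ : Set Y)) :
    Nonempty (_root_.FundamentalGroup ↥((insert a (insert b S))ᶜ : Set Y) x ≃*
      Monoid.Coprod (_root_.FundamentalGroup ↥((insert a S)ᶜ : Set Y) y) (Multiplicative ℤ)) := by
  have h := good ha hb hab hER hbR hS hSE hU
  obtain ⟨E₂⟩ := two_punctures h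
  obtain ⟨E₁⟩ := one_puncture h
  haveI : PathConnectedSpace ↥((insert a (insert b S))ᶜ : Set Y) :=
    isPathConnected_iff_pathConnectedSpace.1 (isPathConnected_P₂ h)
  haveI : PathConnectedSpace ↥((insert a S)ᶜ : Set Y) :=
    isPathConnected_iff_pathConnectedSpace.1 (isPathConnected_P₁ h)
  have Bx := _root_.FundamentalGroup.fundamentalGroupMulEquivOfPathConnected
    (X := ↥((insert a (insert b S))ᶜ : Set Y)) x ⟨x₀ e a b, x₀_mem_P₂ h⟩
  have By := _root_.FundamentalGroup.fundamentalGroupMulEquivOfPathConnected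
    (X := ↥((insert a S)ᶜ : Set Y)) ⟨x₀ e a b, x₀_mem_P₁ h⟩ y
  exact ⟨(Bx.trans E₂).trans (MulEquiv.coprodCongr (E₁.symm.trans By) (MulEquiv.refl _))⟩

/-! #### The chart ball minus the chart segment is path connected -/

omit [T2Space Y] in
/-- Helper: a chart point `e.symm (pt w)` lies in a piece iff its coordinate lies in the model,
for `pt w` in the chart ball. [folklore] -/
private theorem symm_pt_mem_piece_iff' (hab : e a ≠ e b) (hER : ball (e a) R ⊆ e.target) {w : ℂ}
    (hw : pt (e a) (e b) w ∈ ball (e a) R) {A : Set ℂ} :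
    e.symm (pt (e a) (e b) w) ∈ piece e a b R A ↔ w ∈ A := by
  rw [mem_piece, e.right_inv (hER hw), coord_pt hab]
  exact ⟨fun h' => h'.2.2, fun h' => ⟨e.map_target (hER hw), hw, h'⟩⟩

omit [T2Space Y] in
/-- Helper: a point `w = 1 + t + t i` (and its conjugate) just beyond `b`, inside the chart ball. [folklore] -/
private theorem exists_beyond (hab : e a ≠ e b) (hbR : e b ∈ ball (e a) R) :
    ∃ t : ℝ, 0 < t ∧ pt (e a) (e b) ⟨1 + t, t⟩ ∈ ball (e a) R ∧
      pt (e a) (e b) ⟨1 + t, -t⟩ ∈ ball (e a) R ∧ pt (e a) (e b) ⟨-t, t⟩ ∈ ball (e a) R ∧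
      pt (e a) (e b) ⟨-t, -t⟩ ∈ ball (e a) R := by
  have hv : 0 < ‖e b - e a‖ := norm_pos_iff.2 (sub_ne_zero.2 (Ne.symm hab))
  have hbR' : ‖e b - e a‖ < R := by rwa [mem_ball, dist_eq_norm] at hbR
  set t : ℝ := (R - ‖e b - e a‖) / (4 * ‖e b - e a‖) with ht
  have htpos : 0 < t := div_pos (by linarith) (by linarith)
  have key : ∀ w : ℂ, ‖w‖ ≤ 1 + 2 * t → pt (e a) (e b) w ∈ ball (e a) R := by
    intro w hw
    rw [mem_ball, dist_eq_norm]
    simp only [pt, add_sub_cancel_left, norm_mul]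
    have h2 : (1 + 2 * t) * ‖e b - e a‖ = (R + ‖e b - e a‖) / 2 := by
      rw [ht]; field_simp; ring
    calc ‖w‖ * ‖e b - e a‖ ≤ (1 + 2 * t) * ‖e b - e a‖ := by gcongr
      _ = (R + ‖e b - e a‖) / 2 := h2
      _ < R := by linarith
  have hn : ∀ (x y : ℝ), |x| ≤ 1 + t → |y| ≤ t → ‖(⟨x, y⟩ : ℂ)‖ ≤ 1 + 2 * t := fun x y hx hy =>
    (Complex.norm_le_abs_re_add_abs_im _).trans (by simp only; linarith)
  refine ⟨t, htpos, key _ (hn _ _ ?_ ?_), key _ (hn _ _ ?_ ?_), key _ (hn _ _ ?_ ?_),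
    key _ (hn _ _ ?_ ?_)⟩
  all_goals first
    | exact (abs_of_pos (by linarith)).le
    | (rw [abs_of_nonneg (by linarith)])
    | (rw [abs_of_neg (by linarith)]; linarith)

omit [T2Space Y] in
/-- **The chart ball minus the chart segment is path connected** (a disc minus a closed segment in
its interior; union of the four convex pieces `± Im w > 0`, `Re w < 0`, `Re w > 1` of the chart
coordinate `w`). [cite: HatcherAT2002, §1.2 Example 1.22 (setting)] -/
theorem isPathConnected_chartBall_diff_segment (ha : a ∈ e.source) (hb : b ∈ e.source) (hab : a ≠ b)
    (hER : ball (e a) R ⊆ e.target) (hbR : e b ∈ ball (e a) R) :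
    IsPathConnected ((e.source ∩ e ⁻¹' ball (e a) R) \ (e.source ∩ e ⁻¹' segment ℝ (e a) (e b))) := by
  have hab' : e a ≠ e b := fun h => hab (e.injOn ha hb h)
  obtain ⟨t, ht, h1, h2, h3, h4⟩ := exists_beyond hab' hbR
  -- the four pieces
  have hP1 : IsPathConnected (piece e a b R {w | 0 < w.im}) :=
    (isSimplyConnected_pre (inter_subset_left.trans hER) (c := pt (e a) (e b) ⟨-t, t⟩)
      ⟨h3, by rw [mem_preimage, coord_pt hab']; exact ht⟩
      (((convex_ball (e a) R).starConvex h3).inter (starConvex_preimage_coord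
        (by rw [coord_pt hab']; exact convex_im_pos.starConvex (by exact ht))))).isPathConnected
  have hP2 : IsPathConnected (piece e a b R {w | w.im < 0}) :=
    (isSimplyConnected_pre (inter_subset_left.trans hER) (c := pt (e a) (e b) ⟨-t, -t⟩)
      ⟨h4, by rw [mem_preimage, coord_pt hab']; show -t < 0; linarith⟩
      (((convex_ball (e a) R).starConvex h4).inter (starConvex_preimage_coord
        (by rw [coord_pt hab']; exact convex_im_neg.starConvex (by show -t < 0; linarith))))).isPathConnected
  have hcl : Convex ℝ {w : ℂ | w.re < 0} :=
    convex_halfSpace_lt ⟨fun x y => Complex.add_re x y, fun c x => by simp⟩ 0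
  have hcr : Convex ℝ {w : ℂ | 1 < w.re} :=
    convex_halfSpace_gt ⟨fun x y => Complex.add_re x y, fun c x => by simp⟩ 1
  have hP3 : IsPathConnected (piece e a b R {w | w.re < 0}) :=
    (isSimplyConnected_pre (inter_subset_left.trans hER) (c := pt (e a) (e b) ⟨-t, t⟩)
      ⟨h3, by rw [mem_preimage, coord_pt hab']; show -t < 0; linarith⟩
      (((convex_ball (e a) R).starConvex h3).inter (starConvex_preimage_coord
        (by rw [coord_pt hab']; exact hcl.starConvex (by show -t < 0; linarith))))).isPathConnected
  have hP4 : IsPathConnected (piece e a b R {w | 1 < w.re}) :=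
    (isSimplyConnected_pre (inter_subset_left.trans hER) (c := pt (e a) (e b) ⟨1 + t, t⟩)
      ⟨h1, by rw [mem_preimage, coord_pt hab']; show 1 < 1 + t; linarith⟩
      (((convex_ball (e a) R).starConvex h1).inter (starConvex_preimage_coord
        (by rw [coord_pt hab']; exact hcr.starConvex (by show 1 < 1 + t; linarith))))).isPathConnected
  -- the union
  have hU13 : IsPathConnected (piece e a b R {w | 0 < w.im} ∪ piece e a b R {w | w.re < 0}) :=
    hP1.union hP3 ⟨e.symm (pt (e a) (e b) ⟨-t, t⟩), (symm_pt_mem_piece_iff' hab' hER h3).2 ht,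
      (symm_pt_mem_piece_iff' hab' hER h3).2 (show -t < 0 by linarith)⟩
  have hU132 : IsPathConnected ((piece e a b R {w | 0 < w.im} ∪ piece e a b R {w | w.re < 0}) ∪
      piece e a b R {w | w.im < 0}) :=
    hU13.union hP2 ⟨e.symm (pt (e a) (e b) ⟨-t, -t⟩),
      Or.inr ((symm_pt_mem_piece_iff' hab' hER h4).2 (show -t < 0 by linarith)),
      (symm_pt_mem_piece_iff' hab' hER h4).2 (show -t < 0 by linarith)⟩
  have hall : IsPathConnected (((piece e a b R {w | 0 < w.im} ∪ piece e a b R {w | w.re < 0}) ∪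
      piece e a b R {w | w.im < 0}) ∪ piece e a b R {w | 1 < w.re}) :=
    hU132.union hP4 ⟨e.symm (pt (e a) (e b) ⟨1 + t, t⟩),
      Or.inl (Or.inl ((symm_pt_mem_piece_iff' hab' hER h1).2 ht)),
      (symm_pt_mem_piece_iff' hab' hER h1).2 (show 1 < 1 + t by linarith)⟩
  convert hall using 1
  ext y
  simp only [mem_sdiff, mem_union, mem_piece, mem_inter_iff, mem_preimage, mem_setOf_eq,
    mem_segment_iff hab']
  constructor
  · rintro ⟨⟨hys, hyE⟩, hns⟩
    have hns' : ¬ ((coord (e a) (e b) (e y)).im = 0 ∧ 0 ≤ (coord (e a) (e b) (e y)).re ∧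
        (coord (e a) (e b) (e y)).re ≤ 1) := fun hc => hns ⟨hys, hc⟩
    by_cases him : (coord (e a) (e b) (e y)).im = 0
    · by_cases hre : 0 ≤ (coord (e a) (e b) (e y)).re
      · have : ¬ (coord (e a) (e b) (e y)).re ≤ 1 := fun h1 => hns' ⟨him, hre, h1⟩
        exact Or.inr ⟨hys, hyE, not_le.1 this⟩
      · exact Or.inl (Or.inl (Or.inr ⟨hys, hyE, not_le.1 hre⟩))
    · rcases lt_or_gt_of_ne him with hlt | hgt
      · exact Or.inl (Or.inr ⟨hys, hyE, hlt⟩)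
      · exact Or.inl (Or.inl (Or.inl ⟨hys, hyE, hgt⟩))
  · rintro (((⟨hys, hyE, h⟩ | ⟨hys, hyE, h⟩) | ⟨hys, hyE, h⟩) | ⟨hys, hyE, h⟩)
    · exact ⟨⟨hys, hyE⟩, fun hc => (ne_of_gt h) hc.2.1⟩
    · exact ⟨⟨hys, hyE⟩, fun hc => (not_le.2 h) hc.2.2.1⟩
    · exact ⟨⟨hys, hyE⟩, fun hc => (ne_of_lt h) hc.2.1⟩
    · exact ⟨⟨hys, hyE⟩, fun hc => (not_le.2 h) hc.2.2.2⟩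

end Main

end ChartSegment

end Literature.AlgebraicTopology.FundamentalGroup

end
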